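import Summits.QuantumFields.BalabanUV.Beta.FP.TowerNColumnWardLaw
import Summits.QuantumFields.BalabanUV.Beta.FP.LetterInheritanceEnd
import Summits.QuantumFields.BalabanUV.Beta.FP.TowerFTransportRow

/-!
# `BalabanUV.Beta.FP.TowerNWardOfTableLaws` — row D1 ∕ (C1) OWNER «beta-an2», PART 103, ROUTE T (β1), option (3a): **THE END's LAST F-SIDE DISPLAY `hW𝒯 j` REDUCED BY NAME TO THE
# COMPOSITE TABLES' TWO WARD LAWS (S)_j, (W)_j** — the generic coarse Ward END `FP/LetterInheritanceEnd.wardTransversal_flipK_hessKer_vertexOfK_of_letters` INSTANTIATED at the composite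
# triple `(AN R j, (JNat R P (j+1)).S, WN R P j)` at block side `Lc^(j+1)` with EVERY chart-side letter and every bookkeeping letter fed from the tree: (K) PART 102 `relInv_AN`, (H) PART 102
# `colH_ward_AN` (`c_H = ((Lc^(j+1))⁴)⁻¹`), `hM hE hKs hKd` PART 102 §3, `hSl` an2 `locStencil_JNat_S`, `hSt` an2 `JNat_S_St`, `hWl` an2 `vertexFamily₂_WN`, `hWt` road `WN_translate` (one common rate by
# lit `locStencil_mono` ∕ `vertexFamily₂_mono`); `VN R P j = vertexOfK (AN R j) (Lc^(j+1)) (JNat R P (j+1)).S` (`VN_eq`).  WHAT REMAINS AS HYPOTHESES = EXACTLY THE TABLE SIDE: the generators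
# `X X₂ Nr` (localised, `E`-commuting) and the two laws **(S) `hSd : ∀ y, c_H • Σ_{v ∈ box} divV S (N•y + v) = conjV M (X y)`**, **(W) `hWd : ∀ y ν y′, divW W y ν y′ = conjW M 0 (VN … ν y′) (X y) 0
# (X₂ y ν y′) + Nr y ν y′`, `hN0 : tadpole (AN R j) (Nr …) = 0`** — by value TEL2 C10 ∕ WARD (W2); by name OPEN (HWT-SCOPING.md).  Conclusion: `WardTransversal (flipK (hessKer (AN R j) (VN R P j)
# (WN R P j)))` = the END's `hW𝒯 j`, for EVERY `j` (the END displays it for `j ≥ 1`; at `j = 0` it is also the tree theorem `wardRefl_JsB12CombShSym_an1TablesS2_pinned_of_locks`' content in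
# other clothes) and every root family.  (β-function cell `pub-balaban`, BINDER-OWNERS row D1)

WHAT ([folklore]; 0 `def`): `exists_common_rate` (one rate for `hSl`∕`hWl`), **`wardTransversal_AN_of_tableLaws`**.
WHAT THIS IS NOT: (S)(W) NOT proved (displayed); nothing of the END instantiated; nothing of Bałaban's asserted, valued or discharged; 0 estimates; 0∕4 row-D1 binders; NOT (C1), NOT D1,
NEVER «G-an2-4 closed», NOT BetaPertH, NOT continuum, NOT Clay.

HONEST DEPENDENCY (page 1, mandatory): continuum YM on T⁴ ⇐ BetaPertH ∧ nine spine estimates (0/9 proved); BetaPertH ⇐ (D1) ∧ (D4) ∧ CAP+tail;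
G-an2-4 gates asym, D1 and NE2/3/4.  HONEST FRAMING (cell contract, verbatim): «discharging `BetaPertH` makes Bałaban's UV stability UNCONDITIONAL —
a real constructive-QFT result; it is NOT the continuum limit and NOT the Clay problem.»  ABSOLUTE RULE (cell charter, verbatim): «No internally-minted
statement may enter as a cited fact. Every hypothesis is either kernel-proved in this package or a verbatim quotation of a PUBLISHED theorem with page
reference. The manuscript(s) under audit are NOT citable for their own disputed steps — they are the thing under adjudication; programme-internal
(2001/route/tribunal) claims are never citable.»  Row D1 ∕ (C1) OWNER «beta-an2», b2b-balaban-beta-an2 gen 85, 2026-08-30.  No existing file touched.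
-/

noncomputable section

open Finset
open scoped BigOperators
open Literature.MathematicalPhysics.QuantumFieldTheory
open Literature.MathematicalPhysics.QuantumFieldTheory.Balaban1983to89
open Literature.MathematicalPhysics.QuantumFieldTheory.Balaban1983to89.Beta
open ExpKernelCalculus (MKer Decays comp tadpole hessKer VertexFamily₂ shiftK)
open PolarizationSign (WardTransversal)
open KernelWard (divV divW)
open AffineAveraging (Site box toSite)
open OneStepResolventKernel (Fib LocStencil)
open OneStepKernelFamily (vertexOfK flipK)
open BalabanStepJets (locStencil_mono vertexFamily₂_mono)
open Summit.QuantumFields.BalabanUV.Beta.TameKernelCalculus (Loc Spr)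
open Summit.QuantumFields.BalabanUV.Beta.ChartConjugation (conjV conjW)
open Summit.QuantumFields.BalabanUV.Beta.AxialDressingRooted (axEc one_le_of_neZero)
open Summit.QuantumFields.BalabanUV.Beta.RelInvComposite (bhKcomp)
open Summit.QuantumFields.BalabanUV.Beta.KernelWardRelative (gaugeWt)
open Summit.QuantumFields.BalabanUV.Beta.CompositeOneShotJetData (Roots Pins AN VN WN JNat VN_eq)
open Summit.QuantumFields.BalabanUV.Beta.NVertexSectorsPeriodised (JNat_S_St locStencil_JNat_S)
open Summit.QuantumFields.BalabanUV.Beta.NVertexParities (vertexFamily₂_WN)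
open Summit.QuantumFields.BalabanUV.Beta.FP.TowerFTransportRow (WN_translate)
open Summit.QuantumFields.BalabanUV.Beta.FP.LetterInheritanceEnd (wardTransversal_flipK_hessKer_vertexOfK_of_letters)
open Summit.QuantumFields.BalabanUV.Beta.FP.TowerNColumnWardLaw (colH_ward_AN relInv_AN spr_bhKcomp spr_axEc_AN shiftK_AN_all exists_decays_AN)

namespace Summit.QuantumFields.BalabanUV.Beta.FP.TowerNWardOfTableLaws

variable {Lc : ℕ} [NeZero Lc] (R : Roots Lc) (P : Pins)

/-- [folklore] one common localisation rate for the composite stencil family and the composite second-order tables (an2 `locStencil_JNat_S`, `vertexFamily₂_WN`; lit `…_mono`). -/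
theorem exists_common_rate (j : ℕ) : ∃ Cs Cw δ : ℝ, 0 < δ ∧ LocStencil (JNat R P (j + 1)).S Cs δ ∧ VertexFamily₂ (WN R P j) (Lc ^ (j + 1)) Cw δ := by
  obtain ⟨Cs, δs, hδs, hS⟩ := locStencil_JNat_S R P j
  obtain ⟨Cw, δw, hδw, hW⟩ := vertexFamily₂_WN R P j
  have hCs : 0 ≤ Cs := (hS 0 0).nonneg (Sum.inl 0)
  have hCw : 0 ≤ Cw := (hW 0 0 0 0).nonneg (Sum.inl 0)
  exact ⟨Cs, Cw, min δs δw, lt_min hδs hδw, locStencil_mono hS hCs (min_le_left _ _), vertexFamily₂_mono hW hCw (min_le_right _ _)⟩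

/-- [folklore] **`wardTransversal_AN_of_tableLaws` — THE END's `hW𝒯 j` FROM THE COMPOSITE TABLES' WARD LAWS (S)_j, (W)_j ALONE** (every chart-side and bookkeeping letter by name; `j`, the root
family `R` and the pins `P` arbitrary).  Hypotheses = the generic END's table side VERBATIM at `K := AN R j`, `N := Lc^(j+1)`, `M := bhKcomp R.rc Lc (j+1)`, `E := axEc (toSite (R.s (j+1))) (Lc^(j+1))`,
`S := (JNat R P (j+1)).S`, `W := WN R P j`, `cH := ((Lc^(j+1))^(3+1))⁻¹`. -/
theorem wardTransversal_AN_of_tableLaws (j : ℕ)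
    (X : (Fin (3 + 1) → ℤ) → MKer (3 + 1) (Fib 3)) (hX : ∀ y, Loc (X y))
    (hEX : ∀ y, comp (axEc (toSite (R.s (j + 1))) (Lc ^ (j + 1))) (X y) = comp (X y) (axEc (toSite (R.s (j + 1))) (Lc ^ (j + 1))))
    (X₂ Nr : (Fin (3 + 1) → ℤ) → Fin (3 + 1) → (Fin (3 + 1) → ℤ) → MKer (3 + 1) (Fib 3)) (hX₂ : ∀ y ν y', Loc (X₂ y ν y'))
    (hNr : ∀ y ν y', Loc (Nr y ν y'))
    (hEX₂ : ∀ y ν y', comp (axEc (toSite (R.s (j + 1))) (Lc ^ (j + 1))) (X₂ y ν y') = comp (X₂ y ν y') (axEc (toSite (R.s (j + 1))) (Lc ^ (j + 1))))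
    (hSd : ∀ y : Fin (3 + 1) → ℤ, ((((Lc ^ (j + 1) : ℕ) : ℝ)) ^ (3 + 1))⁻¹ • ∑ v ∈ box (3 + 1) (Lc ^ (j + 1)), divV (JNat R P (j + 1)).S ((((Lc ^ (j + 1) : ℕ) : ℤ)) • y + toSite v)
      = conjV (bhKcomp (d := 3) R.rc Lc (j + 1)) (X y))
    (hWd : ∀ (y : Fin (3 + 1) → ℤ) (ν : Fin (3 + 1)) (y' : Fin (3 + 1) → ℤ),
      divW (WN R P j) y ν y' = conjW (bhKcomp (d := 3) R.rc Lc (j + 1)) 0 (vertexOfK (AN R j) (Lc ^ (j + 1)) (JNat R P (j + 1)).S ν y') (X y) 0 (X₂ y ν y') + Nr y ν y')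
    (hN0 : ∀ y ν y', tadpole (AN R j) (Nr y ν y') = 0) :
    WardTransversal (flipK (hessKer (AN R j) (VN R P j) (WN R P j))) := by
  obtain ⟨CK, δK, hδK, hKd⟩ := exists_decays_AN Lc R j
  obtain ⟨Cs, Cw, δ, hδ, hSl, hWl⟩ := exists_common_rate R P j
  rw [VN_eq]
  exact wardTransversal_flipK_hessKer_vertexOfK_of_letters (N := Lc ^ (j + 1)) hKd hδK (shiftK_AN_all Lc R j) (one_le_of_neZero (Lc ^ (j + 1)))
    (spr_bhKcomp Lc R j) (spr_axEc_AN Lc R j) (relInv_AN Lc R j) hδ hSl hWl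
    (fun κ' u t => JNat_S_St R P j κ' u t) (fun μ y ν y' t => WN_translate Lc R P j μ y ν y' t)
    (((((Lc ^ (j + 1) : ℕ) : ℝ)) ^ (3 + 1))⁻¹) (fun y κ' u => colH_ward_AN Lc R j y κ' u)
    X hX hEX X₂ Nr hX₂ hNr hEX₂ hSd hWd hN0

end Summit.QuantumFields.BalabanUV.Beta.FP.TowerNWardOfTableLaws

end
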